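import Summits.ABC.IUTFork.Joshi.Holomorphoids
import Summits.ABC.IUTFork.Joshi.HodgeTheatersJoshi
import Summits.ABC.IUTFork.Joshi.ArithmeticoidCohomology
import HarnessLib

/-!
# K. Joshi, *Construction of Arithmetic Teichmüller Spaces III* §2, III: holomorphoid ↦ `Frob(arith(L)_y)`, the product formula (2.1.1) as «degree zero», and the [J2h] §5–§6 carriers — BRIDGES, proof/defs-light

Companion to `Joshi/Holomorphoids.lean` (p431320) of the abc-iut cell, block E (rung LADDER-ABC:A2.E; seat abc-iut-E-t5,
slot T-05 = [J-III] §2; registry rows `J3:Rmk2.3.4`, `J3:Rmk2.4.2(1)` of `plan/E/JOSHI-DAG.tsv`; merge-debt M-5 of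
`Joshi/HolomorphoidsSchemesElliptic.lean` p432381). FRAMING as in the parent files: the objects of an UNREFEREED preprint
typed as signatures; typed ≠ proved; typed AS A CANDIDATE ≠ endorsed; NO SIDE taken on [IUTchIII] Cor. 3.12 or on any
author (Mochizuki / Scholze–Stix / Joshi); the campaign locates / conditionally verifies; no abc claim. Nothing of another
seat is restated: E-t32's `ATS3.ArithmeticoidAbsDatum` / `frobArith` / `frobArithR` (`Joshi/HodgeTheatersJoshi.lean`
p433245, [J-III] §10.11 with [J2h] Def. 5.14.2 / §5.16) and E-t38's `ATS2half.TopEquivalent` / `ATS2half.Holomorphoid`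
(`Joshi/ArithmeticoidCohomology.lean`, [J2h] Def. 5.2.1 / Def. 6.2.3) are consumed BY NAME.

SOURCES: [J-III] = K. Joshi, arXiv:2401.13508v4 (bib `Joshi2024ATS3`): §2.1 p.19 l.28–36 eq. (2.1.1) (normalized
arithmeticoids, product formula), Rmk. 2.3.4 p.25 l.7–15 («the role of an arithmeticoid `arith(L)_y` is played by a global
Frobenioid of `L`»), Rmk. 2.4.2 (1) p.26 l.26–28 («all other objects of [Mochizuki, 2021a,b,c] such as Frobenioids,
Hodge-Theaters (of all types), prime-strips etc. can be obtained from every holomorphoid `X/arith(L)_y`»), §10.5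
p.133 l.26–p.134 l.6 eqs. (10.5.2)–(10.5.5) (the global arithmetic degree `(x_v) ↦ Σ_v log|x_v|_{L_v}` and the product
formula in logarithmic form); [J2h] = arXiv:2305.10398 (bib `Joshi2023ATS2half`) Def. 5.2.1 p.31 l.44–45, §5.3
(5.3.3)–(5.3.5) p.32 (normalization coordinate `α_y`), Def. 5.14.2, §5.16, Prop. 6.1.2 p.43 l.38–p.44 l.8 (a point of
`𝔍(X/L)` «provides a natural arithmeticoid … hence … Frob(arith(L)) …»), Def. 6.2.3 p.45 l.34–48. Locators `p.N l.a–b` =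
lines of the cell's render page files.

WHAT IS HERE. (A) `ArithFFDatum.toAbsDatum`: the residue-field VALUES `|−|_{K_{y_v}}`, `L ⊂ L_v ↪ K_{y_v}` of the §2
signature in E-t32's rendering, with `toAbsDatum_absAt : … = ArithFFDatum.absAt` (`rfl`); hence the §2-side CONSTRUCTIONS
`ArithFFDatum.frob y = Frob(arith(L)_y)`, `ArithFFDatum.frobR y = Frob(arith(L)_y)^ℝ` and, for a holomorphoid,
`GlobalHolomorphoid.frob / frobR` (Rmk. 2.3.4 / Rmk. 2.4.2 (1) / [J2h] Prop. 6.1.2, Frobenioid clause — CONSTRUCTED over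
the signature, no claim). (B) DERIVED: for a NORMALIZED arithmeticoid `arith(L)^nor_y` (normalization coordinate `α_y`,
[J2h] (5.3.5)) the `α`-weighted global arithmetic degree of a principal divisor, `deg_y(x) = Σ_v α_v · log|x|_{K_{y_v}}`
((10.5.3)–(10.5.4) transported from `Frob(L)` to `Frob(arith(L)_y)^ℝ`), is a homomorphism `L^* → ℝ` (`degPrinHom`) and
VANISHES identically (`degPrin_eq_zero`) — this IS the product formula (2.1.1) in logarithmic form ((10.5.5) for the
deformed arithmeticoid; Rmk. 10.5.6 p.134 l.5–8 «each arithmeticoid `arith(L)_y` provides a natural Frobenioid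
`Frob(arith(L))` and the product formula provides an hyperplane `H_y` (Theorem 4.6.1)»), computed on the principal
divisors `(A.frobR y).div x` of E-t32's realified Frobenioid (`degPrin_eq_finsum_log_div`). Cross-typing note (no import,
nothing restated): E-t8's `ArithPeriodDatum.IsNormalized y` (`Joshi/AdelicAnsatzPeriod.lean`, Thm. 4.6.1) is the
PREDICATE `deg_y(ι_y x) = 0 ∀ x ∈ L^*` on an unbundled period datum; here the same sentence is DERIVED from the first
file's bundled field `NormalizedArithmeticoid.prod_formula` — the two typings of (2.1.1) agree. (C) Merge-debt M-5 PAID in kernel: `ArithFFDatum.IsTopEquivalent A y₁ y₂ ↔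
ATS2half.TopEquivalent A.Y A.K y₁ y₂` (`Iff.rfl`) and the forgetful map `GlobalHolomorphoid G → ATS2half.Holomorphoid`
([J-III] Def. 2.1.2 is [J2h] Def. 6.2.3 plus the normalization (2.1.1)). Style rules as in the parent files (no notation /
axiom / `sorry` / instance; nothing asserted).
-/

noncomputable section

universe u u₁ v₁ u₂

namespace Summit.ABC.IUTFork.Joshi.ATS3

open CategoryTheory

/-! ## A. The §2 signature's residue-field values in E-t32's rendering; `Frob(arith(L)_y)` of an arithmeticoid / holomorphoid -/

namespace ArithFFDatum

variable {L : Type} [Field L] (A : ArithFFDatum.{0} L)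

/-- The residue-field VALUES of the arithmeticoid signature ([J2h] Def. 5.1.1 p.29 l.48–58 «for each `v` one is given an
untilt `(L_v ↪ K_v, K_v^♭ ≃ L̂̄_v^♭)`»; [J-III] §2.1 p.19 l.23–27) in E-t32's rendering `ArithmeticoidAbsDatum` ([J-III]
§10.11, `Joshi/HodgeTheatersJoshi.lean`): `|−|_{K_{y_v}} := A.absK`, `L → K_{y_v} := (L_v ↪ K_{y_v}) ∘ (L → L_v)`. DATA
relating two typings of the same printed objects; nothing asserted. [claim: Joshi2024ATS3, status: disputed] -/
def toAbsDatum : ArithmeticoidAbsDatum L A.V A.Y A.K where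
  abs := A.absK
  emb v y := (A.emb v y).comp (A.toLv v)

/-- The value datum's absolute value at `(v, y)` is `|−|_{K_y}`. [folklore] -/
@[simp] theorem toAbsDatum_abs (v : A.V) (y : A.Y v) : A.toAbsDatum.abs v y = A.absK v y := rfl

/-- The value datum's embedding `L → K_y` is `L → L_v ↪ K_y`. [folklore] -/
@[simp] theorem toAbsDatum_emb_apply (v : A.V) (y : A.Y v) (x : L) :
    A.toAbsDatum.emb v y x = A.emb v y (A.toLv v x) := rfl

/-- The induced valuation of `L` at `v` in E-t32's rendering ((10.3.2) `x ↦ |ι_v x|_{K_{y_v}}`) IS the first file's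
`ArithFFDatum.absAt` ([J2h] §5.3). [folklore] -/
theorem toAbsDatum_absAt (y : A.Points) (v : A.V) (x : L) : A.toAbsDatum.absAt y v x = A.absAt y v x := rfl

/-- **`Frob(arith(L)_y)`** of the arithmeticoid `y ∈ 𝒴_L` of the §2 signature ([J2h] Def. 5.14.2; [J-III] Rmk. 10.5.6,
Thm. 10.11.3.1 (3)) = E-t32's `ArithmeticoidAbsDatum.frobArith` at `y`: `(L^*, ∏_v |O^▹_{K_{y_v}}|, x ↦ (|ι_v x|)_v)`.
CONSTRUCTED over the signature. [claim: Joshi2024ATS3, status: disputed] -/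
abbrev frob (y : A.Points) : ElementaryFrobenioid.{0} := A.toAbsDatum.frobArith y

/-- **`Frob(arith(L)_y)^ℝ`**, the realified Frobenioid of the arithmeticoid `y` ([J2h] §5.16; [J-III] (10.11.4.1)) =
E-t32's `ArithmeticoidAbsDatum.frobArithR` at `y` (value groups `∏_v ℝ^×`, same principal divisors). CONSTRUCTED over the
signature. [claim: Joshi2024ATS3, status: disputed] -/
abbrev frobR (y : A.Points) : ElementaryFrobenioid.{0} := A.toAbsDatum.frobArithR y

/-- The `v`-component of the principal divisor of `x ∈ L^*` in `Frob(arith(L)_y)` is `|x|_{K_{y_v}}` in the sense of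
the first file (`ArithFFDatum.absAt`). [folklore] -/
theorem val_frob_div (y : A.Points) (x : Lˣ) (v : A.V) :
    (((A.frob y).div x v : ℝˣ) : ℝ) = A.absAt y v (x : L) := rfl

/-- The `v`-component of the principal divisor of `x ∈ L^*` in `Frob(arith(L)_y)^ℝ` is `|x|_{K_{y_v}}`. [folklore] -/
theorem val_frobR_div (y : A.Points) (x : Lˣ) (v : A.V) :
    (((A.frobR y).div x v : ℝˣ) : ℝ) = A.absAt y v (x : L) := rfl

/-- `|x|_{K_{y_v}} > 0` for `x ∈ L^*` (the embeddings `L → L_v ↪ K_{y_v}` are injective ring maps of fields). [folklore] -/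
theorem absAt_pos {L : Type u} [Field L] (A : ArithFFDatum.{u} L) (y : A.Points) (v : A.V) {x : L} (hx : x ≠ 0) :
    0 < A.absAt y v x := by
  unfold absAt
  exact (A.absK v (y v)).pos ((map_ne_zero _).2 ((map_ne_zero _).2 hx))

/-- `|x·x′|_{K_{y_v}} = |x|_{K_{y_v}} · |x′|_{K_{y_v}}`. [folklore] -/
theorem absAt_mul {L : Type u} [Field L] (A : ArithFFDatum.{u} L) (y : A.Points) (v : A.V) (x x' : L) :
    A.absAt y v (x * x') = A.absAt y v x * A.absAt y v x' := by
  simp only [absAt, map_mul]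

end ArithFFDatum

namespace GlobalHolomorphoid

variable {L : Type} [Field L] {A : ArithFFDatum.{0} L}
variable {Sch : Type u₁} [Category.{v₁} Sch] {An : A.V → Type u₂} [∀ v, Category.{u} (An v)]
variable {G : AnalyticSignature A Sch An} (H : GlobalHolomorphoid G)

/-- **The Frobenioid of a holomorphoid** — [J-III] Rmk. 2.3.4 p.25 l.12–13 («the role of an arithmeticoid `arith(L)_y`
is played by a global Frobenioid of `L`»), Rmk. 2.4.2 (1) p.26 l.26–28 («Frobenioids … can be obtained from every
holomorphoid»), [J2h] Prop. 6.1.2 p.44 l.4–8: `hol(X/L)_y ↦ Frob(arith(L)_y)`, the §2-side CONSTRUCTION (through the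
point `y` of the holomorphoid and E-t32's `frobArith`). [claim: Joshi2024ATS3, status: disputed] -/
abbrev frob : ElementaryFrobenioid.{0} := A.frob H.point

/-- The realified Frobenioid `Frob(arith(L)_y)^ℝ` of a holomorphoid ((10.11.4.1): the global member of the Hodge theater
`HT(hol(X/L)_y)` is `Frob(arith(L_mod)_y)^ℝ` — E-t32's `HodgeTheaterDatum.hodgeTheaterOf` carries the descent to `L_mod`;
here the undescended `Frob(arith(L)_y)^ℝ`). [claim: Joshi2024ATS3, status: disputed] -/
abbrev frobR : ElementaryFrobenioid.{0} := A.frobR H.point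

/-- The principal divisors of the Frobenioid of a holomorphoid are the valuations `|x|_{K_{y_v}}` of its arithmeticoid.
[folklore] -/
theorem val_frob_div (x : Lˣ) (v : A.V) : ((H.frob.div x v : ℝˣ) : ℝ) = A.absAt H.point v (x : L) := rfl

end GlobalHolomorphoid

/-! ## B. The product formula (2.1.1) as «principal divisors of `Frob(arith(L)_y)^ℝ` have `α`-degree zero» ((10.5.2)–(10.5.5) for `arith(L)^nor_y`) -/

namespace ArithFFDatum.NormalizedArithmeticoid

variable {L : Type u} [Field L] {A : ArithFFDatum.{u} L} (y : A.NormalizedArithmeticoid)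

/-- **The `α`-weighted global arithmetic degree of `x ∈ L` in `arith(L)^nor_y`**: `deg_y(x) = Σ_{v ∈ V_L} α_v · log|x|_{K_{y_v}}`
— [J-III] (10.5.3)–(10.5.4) «`(x_v) ↦ Σ_v log(|x_v|_{L_v})` i.e. by the sum of local arithmetic degrees», written for the
deformed arithmeticoid whose valuations are `|−|_v = |−|^{α_v}_{K_{y_v}}` ([J2h] (5.3.3), normalization coordinate
`α_y = (α_v)` (5.3.5)); a finitely supported sum for `x ≠ 0` by the `finite_support` field of the first file (`∑ᶠ`).
Definition over the signature. [claim: Joshi2024ATS3, status: disputed] -/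
def degPrin (x : L) : ℝ := ∑ᶠ v, y.α v * Real.log (A.absAt y.point v x)

/-- Each local term `α_v · log|x|_{K_{y_v}}` is `log(|x|^{α_v}_{K_{y_v}})` for `x ≠ 0`. [folklore] -/
theorem term_eq_log_rpow {x : L} (hx : x ≠ 0) (v : A.V) :
    y.α v * Real.log (A.absAt y.point v x) = Real.log (A.absAt y.point v x ^ y.α v) :=
  (Real.log_rpow (A.absAt_pos y.point v hx) _).symm

/-- The support of the local degrees of `x ≠ 0` lies in the (finite) support of the factors of (2.1.1). [folklore] -/
theorem support_subset {x : L} (hx : x ≠ 0) :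
    (Function.support fun v => y.α v * Real.log (A.absAt y.point v x)) ⊆
      Function.mulSupport fun v => A.absAt y.point v x ^ y.α v := by
  intro v hv h1
  refine hv ?_
  change y.α v * Real.log (A.absAt y.point v x) = 0
  rw [y.term_eq_log_rpow hx, show A.absAt y.point v x ^ y.α v = 1 from h1, Real.log_one]

/-- Only finitely many local degrees of `x ≠ 0` are non-zero. [folklore] -/
theorem support_finite {x : L} (hx : x ≠ 0) :
    (Function.support fun v => y.α v * Real.log (A.absAt y.point v x)).Finite :=
  (y.finite_support x hx).subset (y.support_subset hx)

/-- **(2.1.1) in logarithmic form — DERIVED**: `deg_y(x) = Σ_v α_v · log|x|_{K_{y_v}} = 0` for every `x ∈ L^*`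
([J-III] (10.5.5) p.134 l.1–4 «one has the (logarithmic form of the) product formula (2.1.1): `Σ_v log(|x|_{L_v}) = 0`»;
Rmk. 10.5.6 «the product formula provides an hyperplane `H_y`»; here for the normalized arithmeticoid `arith(L)^nor_y`
from its `prod_formula` field `∏_v |x|^{α_v}_{K_{y_v}} = 1` — E-t8's predicate `ArithPeriodDatum.IsNormalized`, derived
in the §2 signature). [folklore] -/
theorem degPrin_eq_zero {x : L} (hx : x ≠ 0) : y.degPrin x = 0 := by
  classical
  set s := (y.finite_support x hx).toFinset with hs
  have hsupp : (Function.support fun v => y.α v * Real.log (A.absAt y.point v x)) ⊆ (s : Set A.V) := by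
    rw [hs, Set.Finite.coe_toFinset]; exact y.support_subset hx
  have hmul : (Function.mulSupport fun v => A.absAt y.point v x ^ y.α v) ⊆ (s : Set A.V) := by
    rw [hs, Set.Finite.coe_toFinset]
  have hne : ∀ v ∈ s, A.absAt y.point v x ^ y.α v ≠ 0 := fun v _ =>
    (Real.rpow_pos_of_pos (A.absAt_pos y.point v hx) _).ne'
  unfold degPrin
  rw [finsum_eq_sum_of_support_subset _ hsupp, Finset.sum_congr rfl fun v _ => y.term_eq_log_rpow hx v,
    ← Real.log_prod hne, ← finprod_eq_prod_of_mulSupport_subset _ hmul, y.prod_formula x hx, Real.log_one]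

/-- The local degrees are additive: `α_v·log|x x′| = α_v·log|x| + α_v·log|x′|` for `x, x′ ≠ 0`. [folklore] -/
theorem term_mul {x x' : L} (hx : x ≠ 0) (hx' : x' ≠ 0) (v : A.V) :
    y.α v * Real.log (A.absAt y.point v (x * x')) =
      y.α v * Real.log (A.absAt y.point v x) + y.α v * Real.log (A.absAt y.point v x') := by
  rw [A.absAt_mul, Real.log_mul (A.absAt_pos y.point v hx).ne' (A.absAt_pos y.point v hx').ne', mul_add]

/-- **(10.5.2)–(10.5.4) for `arith(L)^nor_y`: the global arithmetic degree is additive on `L^*`.** [folklore] -/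
theorem degPrin_mul {x x' : L} (hx : x ≠ 0) (hx' : x' ≠ 0) :
    y.degPrin (x * x') = y.degPrin x + y.degPrin x' := by
  unfold degPrin
  rw [finsum_congr fun v => y.term_mul hx hx' v, finsum_add_distrib (y.support_finite hx) (y.support_finite hx')]

/-- **The global arithmetic degree homomorphism `L^* → ℝ` of `arith(L)^nor_y`** ((10.5.2)–(10.5.4): «a global
arithmetic degree homomorphism … which factors through `Φ(L)^gp` as `ℝ` is a group», composed with `L^* → Φ^gp`),
valued in `ℝ` written multiplicatively (E-t34's convention `DegreeFrobenioid.degB`, `Joshi/FrobenioidsJoshiGlobal.lean`).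
[claim: Joshi2024ATS3, status: disputed] -/
def degPrinHom : Lˣ →* Multiplicative ℝ where
  toFun x := Multiplicative.ofAdd (y.degPrin (x : L))
  map_one' := by rw [Units.val_one, y.degPrin_eq_zero one_ne_zero, ofAdd_zero]
  map_mul' x x' := by
    rw [← ofAdd_add, Units.val_mul, y.degPrin_mul x.ne_zero x'.ne_zero]

/-- The degree homomorphism on `x ∈ L^*` is `deg_y(x)`. [folklore] -/
theorem degPrinHom_apply (x : Lˣ) : (y.degPrinHom x).toAdd = y.degPrin (x : L) := rfl

/-- **(10.5.5) for the normalized arithmeticoid: the degree homomorphism is trivial** — the product formula (2.1.1).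
[folklore] -/
theorem degPrinHom_eq_one : y.degPrinHom = 1 :=
  MonoidHom.ext fun x => by
    change Multiplicative.ofAdd (y.degPrin (x : L)) = 1
    rw [y.degPrin_eq_zero x.ne_zero, ofAdd_zero]

end ArithFFDatum.NormalizedArithmeticoid

namespace ArithFFDatum.NormalizedArithmeticoid

variable {L : Type} [Field L] {A : ArithFFDatum.{0} L} (y : A.NormalizedArithmeticoid)

/-- The degree `deg_y(x)` is computed on the PRINCIPAL DIVISOR `((|x|_{K_{y_v}})_v ∈ ∏_v ℝ^×)` of `x` in E-t32's realified
Frobenioid `Frob(arith(L)_y)^ℝ`: `deg_y(x) = Σ_v α_v · log (div(x)_v)` — i.e. `deg_y` factors through `L^* → Φ^{ℝ,gp}`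
as in (10.5.2)–(10.5.4). [folklore] -/
theorem degPrin_eq_finsum_log_div (x : Lˣ) :
    y.degPrin (x : L) = ∑ᶠ v, y.α v * Real.log (((A.frobR y.point).div x v : ℝˣ) : ℝ) := rfl

/-- **Principal divisors of `Frob(arith(L)^nor_y)^ℝ` have `α`-weighted global degree zero** (the product formula (2.1.1) /
(10.5.5) read on the Frobenioid of Rmk. 2.3.4: «the role of an arithmeticoid is played by a global Frobenioid»).
[folklore] -/
theorem finsum_log_div_eq_zero (x : Lˣ) :
    ∑ᶠ v, y.α v * Real.log (((A.frobR y.point).div x v : ℝˣ) : ℝ) = 0 :=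
  (y.degPrin_eq_finsum_log_div x).symm.trans (y.degPrin_eq_zero x.ne_zero)

end ArithFFDatum.NormalizedArithmeticoid

/-! ## C. Merge-debt M-5: the [J2h] §5.2 / §6.2 carriers of E-t38 (`Joshi/ArithmeticoidCohomology.lean`) -/

section ATS2halfBridge

variable {L : Type u} [Field L] (A : ArithFFDatum.{u} L)

/-- **M-5, topological equivalence**: the first file's `ArithFFDatum.IsTopEquivalent` ([J2h] Def. 5.2.1 typed over the §2
signature) IS E-t38's `ATS2half.TopEquivalent` over the carriers `Pt := A.Y`, `K := A.K` (arithmetic ring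
`∏_v K_{y_v}` with the product topology) — definitionally. [folklore] -/
theorem isTopEquivalent_iff_topEquivalent (y₁ y₂ : A.Points) :
    A.IsTopEquivalent y₁ y₂ ↔ ATS2half.TopEquivalent A.Y A.K y₁ y₂ := Iff.rfl

/-- Hence Thm. 2.3.1's ground `ExistTopInequivalentArithmeticoids` ([J2h] Thm. 5.5.2 (7)) reads: two points of `∏_v |Y_v|`
that are not `ATS2half.TopEquivalent`. [folklore] -/
theorem existTopInequivalent_iff (A : ArithFFDatum.{u} L) :
    A.ExistTopInequivalentArithmeticoids ↔ ∃ y₁ y₂ : A.Points, ¬ ATS2half.TopEquivalent A.Y A.K y₁ y₂ := Iff.rfl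

variable {A}
variable {Sch : Type u₁} [Category.{v₁} Sch] {An : A.V → Type u₂} [∀ v, Category.{u} (An v)]
variable {G : AnalyticSignature A Sch An}

/-- **M-5, holomorphoids**: a holomorphoid in the sense of [J-III] Def. 2.1.2 (first file, `GlobalHolomorphoid G`) gives
E-t38's [J2h] Def. 6.2.3 holomorphoid of the SAME scheme `X` — the point `y = (y_v)_v` and the morphisms
`M(K_{y_v}) → X^an_{L_v}` (6.2.4), with `Morph v y_v :=` the `An v`-morphisms `M(K_{y_v}) ⟶ X^an_{L_v}` of the analytic
signature; [J-III] §2.1 adds only the normalization (2.1.1), forgotten here. [folklore] -/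
def GlobalHolomorphoid.toATS2half (H : GlobalHolomorphoid G) :
    ATS2half.Holomorphoid A.Y (fun v y => G.spectrum v y ⟶ (G.an v).obj H.X) :=
  ⟨H.point, H.basePoint⟩

/-- The [J2h] holomorphoid of `H` has the same arithmeticoid `y`. [folklore] -/
theorem GlobalHolomorphoid.toATS2half_arith (H : GlobalHolomorphoid G) : H.toATS2half.arith = H.point := rfl

/-- The [J2h] holomorphoid of `H` has the same geometric base-points (6.2.4) = (2.1.3). [folklore] -/
theorem GlobalHolomorphoid.toATS2half_morph (H : GlobalHolomorphoid G) (v : A.V) :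
    H.toATS2half.morph v = H.basePoint v := rfl

/-- Conversely, a [J2h] Def. 6.2.3 holomorphoid of `X` whose arithmeticoid carries a normalization (2.1.1) is a [J-III]
Def. 2.1.2 holomorphoid. [folklore] -/
def GlobalHolomorphoid.ofATS2half (X : Sch) (y : A.NormalizedArithmeticoid)
    (h : ATS2half.Holomorphoid A.Y (fun v y => G.spectrum v y ⟶ (G.an v).obj X)) (hy : h.arith = y.point) :
    GlobalHolomorphoid G :=
  ⟨y, X, fun v => eqToHom (by rw [← hy]) ≫ h.morph v⟩

/-- Round trip: forgetting the normalization of `ofATS2half` returns the given [J2h] holomorphoid. [folklore] -/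
theorem GlobalHolomorphoid.toATS2half_ofATS2half (X : Sch) (y : A.NormalizedArithmeticoid)
    (h : ATS2half.Holomorphoid A.Y (fun v y => G.spectrum v y ⟶ (G.an v).obj X)) (hy : h.arith = y.point) :
    (GlobalHolomorphoid.ofATS2half X y h hy).toATS2half = h := by
  obtain ⟨a, m⟩ := h
  change a = y.point at hy
  subst hy
  simp [GlobalHolomorphoid.ofATS2half, GlobalHolomorphoid.toATS2half, GlobalHolomorphoid.point]

end ATS2halfBridge

end Summit.ABC.IUTFork.Joshi.ATS3

end
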